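import Summits.AtomisticToContinuum.FouriersLaw.Theorems.HiddenChargeMazurStaticKuboGradientBoundReduction
import Summits.AtomisticToContinuum.FouriersLaw.Theorems.OddSectorIrreversibilityCorrectorTheorySmooth
import HarnessLib

/-!
# `HiddenChargeMazur.StaticKubo`, line `birth`, stub `stub_transfer` — from the weighted pair-Lipschitz
bound for the Kubo corrector to the registered `stub_gradientBound`

Helper file (`--supports stmt-AtomisticToContinuum-13510`, crux decl `HiddenChargeMazur.StaticKubo`,
registered stub `stub_transfer` (S7) of the skeleton `Cruxes/StaticKubo/Lines/birth.lean`, rev 4).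

For the pinned anharmonic chain `pinnedChain ω₂ lam β γ` (all parameters `> 0`), `T > 0`, `N ≥ 2`:
ASSUMING the weighted pair-Lipschitz bound for the everywhere-defined Kubo corrector
`u⋆(x) = ∫_{(0,∞)} P_t J(x) dt` (`J = Σ_i bondCurrent i`),

  `|u⋆ x − u⋆ y| ≤ A ‖x − y‖ (e^{θ₁H(x)} + e^{θ₁H(y)})` whenever `‖x − y‖ ≤ 1`, for every `0 < θ₁ < 1/(2T)`,

the registered rev-3 stub `stub_gradientBound` follows.  Proof: at each parameter point take the
smooth corrector `u` of `Corrector.corrector_smooth` (`u⋆ = u` a.e., `u ∈ C^∞`, `L_{T,T} u = −J`,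
`|u| ≤ K e^{ϑH}`) at `ϑ = θ₁ = 1/(4T)`; `u⋆` is continuous (locally Lipschitz), so `u⋆ = u` everywhere
(`Measure.eq_of_ae_eq`, Lebesgue measure on phase space is open-positive); the pair bound and the converse
mean value inequality (`HasFDerivAt.le_of_lip'`) give `‖Du(x)‖ ≤ A (2e^{θ₁H(x)} + 1) ≤ 3A e^{θ₁H(x)}`,
hence `|∂_{p_i}u|, |∂_{q_i}u| ≤ 3A e^{θ₁H}`; so `u` is the witness of the landed reduction
`stub_gradientBound_of_witness`. [folklore]
-/

noncomputable section

open MeasureTheory Filter Topology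
open scoped NNReal ENNReal
open Literature.MathematicalPhysics.KineticTheory.HeatConduction Literature.MathematicalPhysics.KineticTheory
open Literature.Probability.Process OscillatorChain

namespace Summit.AtomisticToContinuum.FouriersLaw.Cruxes.StaticKubo.Birth.Stubs

/-! ### Two facts on functions with a local weighted pair-Lipschitz bound -/

/-- A function with a local weighted pair bound `|f x − f y| ≤ A‖x − y‖(W x + W y)` (`‖x − y‖ ≤ 1`,
`W` continuous) is continuous. [folklore] -/
theorem continuous_of_pairBound {E : Type*} [NormedAddCommGroup E] (f W : E → ℝ) {A : ℝ}
    (hW : Continuous W)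
    (h : ∀ x y, ‖x - y‖ ≤ 1 → |f x - f y| ≤ A * ‖x - y‖ * (W x + W y)) : Continuous f := by
  refine continuous_iff_continuousAt.2 fun x => tendsto_sub_nhds_zero_iff.1 ?_
  have hb : Tendsto (fun y => A * ‖x - y‖ * (W x + W y)) (𝓝 x) (𝓝 0) := by
    have hc : Continuous fun y => A * ‖x - y‖ * (W x + W y) := by fun_prop
    simpa using hc.tendsto x
  refine squeeze_zero_norm' ?_ hb
  filter_upwards [Metric.ball_mem_nhds x one_pos] with y hy
  have hxy : ‖x - y‖ ≤ 1 := by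
    rw [norm_sub_rev, ← dist_eq_norm]; exact (Metric.mem_ball.1 hy).le
  rw [Real.norm_eq_abs, abs_sub_comm]
  exact h x y hxy

/-- Converse mean value inequality for a local weighted pair bound: if
`|f x − f y| ≤ A‖x − y‖(W x + W y)` for `‖x − y‖ ≤ 1` (`A ≥ 0`, `W` continuous, `W x₀ ≥ 0`) and `f` has
derivative `f'` at `x₀`, then `‖f'‖ ≤ A (2 W x₀ + 1)`. [folklore] -/
theorem norm_fderiv_le_of_pairBound {E : Type*} [NormedAddCommGroup E] [NormedSpace ℝ E]
    (f W : E → ℝ) {A : ℝ} (hA : 0 ≤ A) (hW : Continuous W)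
    (h : ∀ x y, ‖x - y‖ ≤ 1 → |f x - f y| ≤ A * ‖x - y‖ * (W x + W y))
    {x₀ : E} (hx₀ : 0 ≤ W x₀) {f' : E →L[ℝ] ℝ} (hf : HasFDerivAt f f' x₀) :
    ‖f'‖ ≤ A * (2 * W x₀ + 1) := by
  have hWx : ∀ᶠ y in 𝓝 x₀, W y < W x₀ + 1 := (hW.tendsto x₀).eventually_lt_const (lt_add_one _)
  refine hf.le_of_lip' (by positivity) ?_
  filter_upwards [Metric.ball_mem_nhds x₀ one_pos, hWx] with y hy hWy
  have hxy : ‖x₀ - y‖ ≤ 1 := by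
    rw [norm_sub_rev, ← dist_eq_norm]; exact (Metric.mem_ball.1 hy).le
  have hnn : 0 ≤ ‖x₀ - y‖ := norm_nonneg _
  calc ‖f y - f x₀‖ = |f x₀ - f y| := by rw [Real.norm_eq_abs, abs_sub_comm]
    _ ≤ A * ‖x₀ - y‖ * (W x₀ + W y) := h x₀ y hxy
    _ ≤ A * ‖x₀ - y‖ * (2 * W x₀ + 1) := by
        apply mul_le_mul_of_nonneg_left _ (mul_nonneg hA hnn)
        linarith
    _ = A * (2 * W x₀ + 1) * ‖y - x₀‖ := by rw [norm_sub_rev]; ring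

/-! ### Coordinate derivatives are bounded by the Fréchet derivative -/

variable {N : ℕ}

/-- `|∂_{p_i} f(x)| ≤ ‖Df(x)‖` for differentiable `f` (`‖(0, e_i)‖ = 1`). [folklore] -/
theorem abs_partialP_le_norm_fderiv {f : PhaseSpace N → ℝ} (hf : Differentiable ℝ f) (i : Fin N)
    (x : PhaseSpace N) : |partialP i f x| ≤ ‖fderiv ℝ f x‖ := by
  have hx := congrFun (partialP_eq_fderiv hf i) x
  rw [hx, ← Real.norm_eq_abs]
  calc ‖fderiv ℝ f x ((0, Pi.single i 1) : PhaseSpace N)‖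
      ≤ ‖fderiv ℝ f x‖ * ‖((0, Pi.single i 1) : PhaseSpace N)‖ := ContinuousLinearMap.le_opNorm _ _
    _ ≤ ‖fderiv ℝ f x‖ * 1 := by
        gcongr
        simp [Prod.norm_mk, Pi.norm_single]
    _ = ‖fderiv ℝ f x‖ := mul_one _

/-- `|∂_{q_i} f(x)| ≤ ‖Df(x)‖` for differentiable `f` (`‖(e_i, 0)‖ = 1`). [folklore] -/
theorem abs_partialQ_le_norm_fderiv {f : PhaseSpace N → ℝ} (hf : Differentiable ℝ f) (i : Fin N)
    (x : PhaseSpace N) : |partialQ i f x| ≤ ‖fderiv ℝ f x‖ := by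
  have hx := congrFun (partialQ_eq_fderiv hf i) x
  rw [hx, ← Real.norm_eq_abs]
  calc ‖fderiv ℝ f x ((Pi.single i 1, 0) : PhaseSpace N)‖
      ≤ ‖fderiv ℝ f x‖ * ‖((Pi.single i 1, 0) : PhaseSpace N)‖ := ContinuousLinearMap.le_opNorm _ _
    _ ≤ ‖fderiv ℝ f x‖ * 1 := by
        gcongr
        simp [Prod.norm_mk, Pi.norm_single]
    _ = ‖fderiv ℝ f x‖ := mul_one _

/-! ### The transfer: from the pair bound for `u⋆` to the full growth bound for the smooth `u` -/

/-- **Transfer lemma.** If `g` has the local weighted pair bound with weight `W ≥ 1` (continuous),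
`g = u` Lebesgue-a.e. for a differentiable `u` with `|u| ≤ K W`, then
`|u| + |∂_{p_i}u| + |∂_{q_i}u| ≤ (K + 6 max(A,0)) W` everywhere: `g` is continuous, so `g = u`
everywhere (Lebesgue measure on phase space charges open sets), and the converse mean value
inequality bounds `‖Du‖ ≤ max(A,0)(2W + 1) ≤ 3 max(A,0) W`. [folklore] -/
theorem growth_of_pairBound {g u W : PhaseSpace N → ℝ} {A K : ℝ} (hW : Continuous W)
    (hW1 : ∀ x, 1 ≤ W x)
    (hA : ∀ x y, ‖x - y‖ ≤ 1 → |g x - g y| ≤ A * ‖x - y‖ * (W x + W y))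
    (hu : Differentiable ℝ u) (hae : g =ᵐ[volume] u) (hK : ∀ x, |u x| ≤ K * W x) :
    ∀ (z : PhaseSpace N) (i : Fin N), |u z| + |partialP i u z| + |partialQ i u z| ≤
      (K + 6 * max A 0) * W z := by
  haveI := isAddHaarMeasure_volume_phaseSpace N
  -- the pair bound with the nonnegative constant `max A 0`
  have hA' : ∀ x y, ‖x - y‖ ≤ 1 → |g x - g y| ≤ max A 0 * ‖x - y‖ * (W x + W y) := by
    intro x y hxy
    refine (hA x y hxy).trans (mul_le_mul_of_nonneg_right
      (mul_le_mul_of_nonneg_right (le_max_left A 0) (norm_nonneg _)) ?_)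
    linarith [hW1 x, hW1 y]
  -- `g` is continuous, hence `g = u` everywhere
  have hgc : Continuous g := continuous_of_pairBound g W hW hA'
  obtain rfl : g = u := Measure.eq_of_ae_eq hae hgc hu.continuous
  intro z i
  have hWz : 0 ≤ W z := zero_le_one.trans (hW1 z)
  have hD : ‖fderiv ℝ g z‖ ≤ max A 0 * (2 * W z + 1) :=
    norm_fderiv_le_of_pairBound g W (le_max_right A 0) hW hA' hWz (hu z).hasFDerivAt
  have hD' : max A 0 * (2 * W z + 1) ≤ 3 * max A 0 * W z := by
    have : 2 * W z + 1 ≤ 3 * W z := by linarith [hW1 z]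
    calc max A 0 * (2 * W z + 1) ≤ max A 0 * (3 * W z) :=
          mul_le_mul_of_nonneg_left this (le_max_right A 0)
      _ = 3 * max A 0 * W z := by ring
  have hP := (abs_partialP_le_norm_fderiv hu i z).trans (hD.trans hD')
  have hQ := (abs_partialQ_le_norm_fderiv hu i z).trans (hD.trans hD')
  calc |g z| + |partialP i g z| + |partialQ i g z|
      ≤ K * W z + 3 * max A 0 * W z + 3 * max A 0 * W z := add_le_add_three (hK z) hP hQ
    _ = (K + 6 * max A 0) * W z := by ring

/-! ### The registered stub -/

/-- **S7 — `stub_transfer` (from the weighted pair-Lipschitz bound for `u⋆` to the registered `stub_gradientBound`).**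
Given the conclusion of S6: at each parameter point take the smooth corrector `u` of `Corrector.corrector_smooth`
(`u⋆ = u` a.e., `L_{T,T}u = −J`, `|u| ≤ K e^{ϑH}`) at `ϑ = θ₁ = 1/(4T)`; `u⋆` is continuous (locally Lipschitz
by S6), so `u = u⋆` everywhere (`Measure.eq_of_ae_eq`); the pair bound gives `‖Du(x)‖ ≤ 3A e^{θ₁H(x)}`, hence
`|∂_{p_i}u|, |∂_{q_i}u| ≤ 3A e^{θ₁H}`; `u` is then the witness of `stub_gradientBound_of_witness`
(value-class `C²` solutions differ by constants). [folklore] -/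
theorem stub_transfer :
    (∀ ω₂ lam β γ : ℝ, 0 < ω₂ → 0 < lam → 0 < β → 0 < γ → ∀ N : ℕ, 2 ≤ N → ∀ T : ℝ, 0 < T →
      ∀ θ₁ : ℝ, 0 < θ₁ → θ₁ < 1 / (2 * T) →
      ∃ A : ℝ, ∀ x y : PhaseSpace N, ‖x - y‖ ≤ 1 →
        |(∫ t in Set.Ioi (0 : ℝ), ∫ z, (∑ i : Fin N, (pinnedChain ω₂ lam β γ).bondCurrent N i z)
              ∂((pinnedChain ω₂ lam β γ).transitionKernel N T T t.toNNReal x)) -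
            ∫ t in Set.Ioi (0 : ℝ), ∫ z, (∑ i : Fin N, (pinnedChain ω₂ lam β γ).bondCurrent N i z)
              ∂((pinnedChain ω₂ lam β γ).transitionKernel N T T t.toNNReal y)| ≤
          A * ‖x - y‖ *
            (Real.exp (θ₁ * (pinnedChain ω₂ lam β γ).hamiltonian N x) +
              Real.exp (θ₁ * (pinnedChain ω₂ lam β γ).hamiltonian N y))) →
    ∀ ω₂ lam β γ : ℝ, 0 < ω₂ → 0 < lam → 0 < β → 0 < γ → ∀ P : Literature.MathematicalPhysics.KineticTheory.HeatConduction.OscillatorChain, P = Literature.MathematicalPhysics.KineticTheory.HeatConduction.pinnedChain ω₂ lam β γ → ∀ T : ℝ, 0 < T → ∀ N : ℕ, 2 ≤ N → ∀ F : Literature.MathematicalPhysics.KineticTheory.HeatConduction.PhaseSpace N → ℝ, ContDiff ℝ 2 F → (∃ C θ : ℝ, θ < 1 / (2 * T) ∧ ∀ z : Literature.MathematicalPhysics.KineticTheory.HeatConduction.PhaseSpace N, |F z| ≤ C * Real.exp (θ * P.hamiltonian N z)) → (∀ z : Literature.MathematicalPhysics.KineticTheory.HeatConduction.PhaseSpace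 N, P.generator N T T F z = -(∑ i : Fin N, P.bondCurrent N i z)) → ∃ C θ : ℝ, θ < 1 / (2 * T) ∧ ∀ (z : Literature.MathematicalPhysics.KineticTheory.HeatConduction.PhaseSpace N) (i : Fin N), |F z| + |Literature.MathematicalPhysics.KineticTheory.HeatConduction.partialP i F z| + |Literature.MathematicalPhysics.KineticTheory.HeatConduction.partialQ i F z| ≤ C * Real.exp (θ * P.hamiltonian N z) := by
  intro hLip
  refine stub_gradientBound_of_witness ?_
  intro ω₂ lam β γ hω hl hβ hγ T hT N hN
  have hN' : 0 < N := by omega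
  -- the exponent `θ₁ = ϑ = 1/(4T)`
  have hθ₀ : 0 < 1 / (4 * T) := by positivity
  have hθ₁ : 1 / (4 * T) < 1 / (2 * T) := by
    rw [div_lt_div_iff_of_pos_left one_pos (by positivity) (by positivity)]
    linarith
  have hθ₂ : 1 / (4 * T) < 1 / T := by
    rw [div_lt_div_iff_of_pos_left one_pos (by positivity) hT]
    linarith
  -- the smooth corrector and its value bound
  obtain ⟨u, hu, hae, hLu, hbound⟩ :=
    Summit.AtomisticToContinuum.FouriersLaw.Theorems.OddSectorIrreversibility.Corrector.corrector_smooth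
      hω hl hβ hγ hT hN'
  obtain ⟨K, -, hK⟩ := hbound (1 / (4 * T)) hθ₀ hθ₂
  -- the pair bound for the everywhere-defined corrector
  obtain ⟨A, hA⟩ := hLip ω₂ lam β γ hω hl hβ hγ N hN T hT (1 / (4 * T)) hθ₀ hθ₁
  have hu2 : ContDiff ℝ 2 u := hu.of_le (by norm_cast)
  have hHc : Continuous ((pinnedChain ω₂ lam β γ).hamiltonian N) :=
    pinnedChain_continuous_hamiltonian ω₂ lam β γ N
  have hWc : Continuous fun z => Real.exp (1 / (4 * T) * (pinnedChain ω₂ lam β γ).hamiltonian N z) := by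
    fun_prop
  have hW1 : ∀ z, 1 ≤ Real.exp (1 / (4 * T) * (pinnedChain ω₂ lam β γ).hamiltonian N z) := fun z =>
    Real.one_le_exp (mul_nonneg hθ₀.le (pinnedChain_hamiltonian_nonneg hω.le hl.le hβ.le γ N z))
  refine ⟨u, hu2, hLu, K + 6 * max A 0, 1 / (4 * T), hθ₁, ?_⟩
  exact growth_of_pairBound (W := fun z => Real.exp (1 / (4 * T) * (pinnedChain ω₂ lam β γ).hamiltonian N z))
    (g := fun x => ∫ t in Set.Ioi (0 : ℝ), ∫ z, (∑ i : Fin N, (pinnedChain ω₂ lam β γ).bondCurrent N i z)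
      ∂((pinnedChain ω₂ lam β γ).transitionKernel N T T t.toNNReal x))
    hWc hW1 hA (hu2.differentiable (by norm_num)) hae hK

end Summit.AtomisticToContinuum.FouriersLaw.Cruxes.StaticKubo.Birth.Stubs

end
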